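import Summits.BirchSwinnertonDyer.BirchSwinnertonDyer.Theorems.BiquadraticEisensteinDescentSymbolicMonskyPatternFreeDefs
import HarnessLib

set_option linter.dupNamespace false -- `Summit.BirchSwinnertonDyer.BirchSwinnertonDyer.Theorems.…` (summit = sub)
set_option autoImplicit false

/-!
# Route `BiquadraticEisensteinDescent` — DEFINITIONS (D-0017 `Theorems/<RouteSlug><Topic>Defs.lean`, reviewed):
# the MULTI-STAGE (closure) pattern-free check of the symbolic Monsky engine (crux `HeegnerTwistCouplingInSupply`, stmt-BirchSwinnertonDyer-21381)

Cell `pub/bsd-wall`, width-prover seat `bsd-wall-cm-bed-w3` g21 (explicit-unit), route `BiquadraticEisensteinDescent`, crux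
stmt-BirchSwinnertonDyer-21381 `HeegnerTwistCouplingInSupply`; extends w3 g20's pattern-free criterion
(`…SymbolicMonskyPatternFreeDefs`: `admissibleSel`, `pfGens`, `solveSel`, `diffCheckRows`, `SymbData.pfCheckOdd/Even`,
`pfRecipeOdd/Even`), which certifies by ONE Boolean check that Monsky's matrix stays invertible for EVERY assignment of the mutual
symbols `(q_j/q_i)` of the auxiliary block `Q`.

WHY A SECOND CHECK. The one-stage criterion asks that the pattern-independent functionals (rows outside `Q`, the two `Q`-row sums)
force a kernel vector to be constant on `Q` in BOTH halves at once. It misses the pattern-free families of the «aligned» exceptional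
configurations (w3 g19 / g20 memos: `p ≡ 3 (8)`, three `r_i ≡ 5 (8)`, aligned symbols; `t = t₀ + 1` auxiliary primes), which are
pattern-free by a STAGED mechanism: in Monsky's matrix `M = (A + D₂, D₂; D₂, A + D₋₂)` the mutual symbols enter a half-one row `q ∈ Q`
only through the coordinates `z_(inl q')`, `q' ∈ Q`, a half-two row only through the `z_(inr q')`, and the SUM of the two rows of `q`
only through the sums `z_(inl q') + z_(inr q')` (reciprocity is pattern-free). Hence, once a kernel vector is known to be `Q`-constant in
ONE of the three directions `u = inl`, `v = inr`, `w = inl + inr`, the corresponding `Q`-rows (resp. row sums) become pattern-independent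
too and may be used to certify constancy in a second direction; two directions give the third, and then `det M(reference pattern) = 1`
finishes exactly as in the one-stage criterion. This file defines the resulting CLOSURE CHECK: for some ordered pair of distinct
directions `(δ₁, δ₂)`, every `δ₁`-difference functional is certified from stage-one-admissible selectors (`admissibleSel`, as in g20) and
every `δ₂`-difference functional from selectors admissible GIVEN `δ₁` (`admissibleSel2`). As in g20's design the `𝔽₂` elimination oracle
(`solveSel`) is UNVERIFIED; only "the selector is admissible" and "the selected rows XOR to the target" are consumed. Soundness:
`…HeegnerTwistCouplingInSupplySymbolicMonskyClosure.lean` (abstract) and `…ClosureSymb.lean` (★ `SymbData.det_monskyOddS_eq_one_of_pfClosureCheckOdd`,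
general-`k` `det_dataK_odd_of_pfClosureRecipeOdd`, doors). The one-stage check is the special case `(δ₁, δ₂) = (u, v)` with both stages
certified from stage-one selectors; on every pattern-free family found so far (`k ≤ 4`, both parities, the aligned class included) the
closure check accepts (w3 g21 memo PATTERN-FREE-STRUCTURE-w3g21).

* §1 direction codes (`0 = u`, `1 = v`, `2 = w`), difference targets `diffTarget`, stage-two admissibility `admissibleSel2` and
  generators `pfGens2`, the generic verified check `selCheck`, the stage checks `stageCheck1` / `stageCheck2`, `closureCheckRows`;
* §2 `SymbData.pfClosureCheckOdd/Even` (`detCheck… && closureCheckRows …`) and the general-`k` recipe checks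
  `pfClosureRecipeOdd/Even base aux` (Heegner check + closure check of `dataK` at the reference pattern).

DEFINITIONS ONLY (computable functions); no theorem, no named fact, no `sorry`, no instance, no notation. Nothing here asserts anything
about Selmer groups, `L`-values, the crux or BSD. References: [HeathBrown1994] D. R. Heath-Brown, Invent. Math. 118 (1994) 331–370,
appendix by P. Monsky (typescript pp. 38–42); [Feng1996] K. Feng, Acta Arith. 75 (1996) 71–83, §2.
-/

namespace Summit.BirchSwinnertonDyer.BirchSwinnertonDyer.Theorems.SymbolicMonsky

/-! ## §1 Directions, targets, staged admissibility, the closure check on bitmask rows -/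

/-- The DIFFERENCE TARGET of direction `δ` between the auxiliary indices `q₀` and `q` (bitmask over the `2k` coordinates; coordinate
`i < k` is `z_(inl i)`, coordinate `k + i` is `z_(inr i)`): `δ = 0` (`u`): `z_(inl q₀) + z_(inl q)`; `δ = 1` (`v`): `z_(inr q₀) + z_(inr q)`;
otherwise (`w`): the sum of the two. -/
def diffTarget (k δ : ℕ) (q₀ q : ℕ) : ℕ :=
  if δ = 0 then 2 ^ q₀ ^^^ 2 ^ q
  else if δ = 1 then 2 ^ (k + q₀) ^^^ 2 ^ (k + q)
  else (2 ^ q₀ ^^^ 2 ^ q) ^^^ (2 ^ (k + q₀) ^^^ 2 ^ (k + q))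

/-- STAGE-TWO ADMISSIBILITY of a row selector `c` (bit `l` selects row `l`; row `i < k` is half one, row `k + i` half two) for the
auxiliary block `Q`, GIVEN that direction `δ₁` is already certified: `δ₁ = 0` (half-one `Q`-rows usable individually): constant on the
half-two `Q`-rows; `δ₁ = 1`: constant on the half-one `Q`-rows; otherwise (`w`: the row SUMS `row_q + row_(k+q)` usable individually):
`c_q + c_(k+q)` constant over `q ∈ Q`. -/
def admissibleSel2 (k : ℕ) (Q : Fin k → Bool) (δ₁ : ℕ) (c : ℕ) : Bool :=
  (List.finRange k).all fun i => (List.finRange k).all fun j =>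
    !(Q i && Q j) ||
      (if δ₁ = 0 then c.testBit (k + i.val) == c.testBit (k + j.val)
       else if δ₁ = 1 then c.testBit i.val == c.testBit j.val
       else xor (c.testBit i.val) (c.testBit (k + i.val)) == xor (c.testBit j.val) (c.testBit (k + j.val)))

/-- Generators handed to the oracle at STAGE TWO given `δ₁`: the stage-one generators (`pfGens`: rows outside `Q` and the two `Q`-row
sums) together with, for `q ∈ Q`: the half-one row `q` (`δ₁ = 0`), the half-two row `k + q` (`δ₁ = 1`), or the row sum
`row_q XOR row_(k+q)` with selector `2^q + 2^(k+q)` (`δ₁ = w`). `R` = the `2k` bitmask rows. -/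
def pfGens2 (k : ℕ) (Q : Fin k → Bool) (δ₁ : ℕ) (R : List ℕ) : List (ℕ × ℕ) :=
  let inn := (List.finRange k).filter Q
  pfGens k Q R ++
    (if δ₁ = 0 then inn.map fun i => (R.getD i.val 0, 2 ^ i.val)
     else if δ₁ = 1 then inn.map fun i => (R.getD (k + i.val) 0, 2 ^ (k + i.val))
     else inn.map fun i => (R.getD i.val 0 ^^^ R.getD (k + i.val) 0, 2 ^ i.val ^^^ 2 ^ (k + i.val)))

/-- Generic VERIFIED CHECK for one target functional `δt`: the oracle's selector over `gens` passes the admissibility test `adm` and the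
selected rows of `R` XOR to `δt`. Only these two verified facts are ever consumed. -/
def selCheck (adm : ℕ → Bool) (gens : List (ℕ × ℕ)) (R : List ℕ) (δt : ℕ) : Bool :=
  let c := solveSel gens δt
  adm c && (xorSelFrom c 0 R == δt)

/-- STAGE ONE for direction `δ₁`: with `q₀` the first index of `Q`, every `δ₁`-difference target between `q₀` and `q ∈ Q` is certified
from stage-one-admissible selectors (`admissibleSel`, generators `pfGens`). Vacuous when `Q` has at most one element. -/
def stageCheck1 (k : ℕ) (Q : Fin k → Bool) (R : List ℕ) (δ₁ : ℕ) : Bool :=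
  match (List.finRange k).filter Q with
  | [] => true
  | q₀ :: qs => qs.all fun q => selCheck (admissibleSel k Q) (pfGens k Q R) R (diffTarget k δ₁ q₀.val q.val)

/-- STAGE TWO for direction `δ₂` given `δ₁`: every `δ₂`-difference target is certified from selectors admissible given `δ₁`
(`admissibleSel2`, generators `pfGens2`). -/
def stageCheck2 (k : ℕ) (Q : Fin k → Bool) (R : List ℕ) (δ₁ δ₂ : ℕ) : Bool :=
  match (List.finRange k).filter Q with
  | [] => true
  | q₀ :: qs => qs.all fun q => selCheck (admissibleSel2 k Q δ₁) (pfGens2 k Q δ₁ R) R (diffTarget k δ₂ q₀.val q.val)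

/-- The six ordered pairs of distinct directions. -/
def dirPairs : List (ℕ × ℕ) := [(0, 1), (0, 2), (1, 0), (1, 2), (2, 0), (2, 1)]

/-- The CLOSURE CHECK on the `2k` bitmask rows: for SOME ordered pair of distinct directions `(δ₁, δ₂)`, stage one certifies `δ₁` and
stage two certifies `δ₂` given `δ₁`. (Two certified directions make a kernel vector `Q`-constant in both halves.) -/
def closureCheckRows (k : ℕ) (Q : Fin k → Bool) (R : List ℕ) : Bool :=
  dirPairs.any fun p => stageCheck1 k Q R p.1 && stageCheck2 k Q R p.1 p.2

/-! ## §2 The closure check on symbol data and on general-`k` recipes -/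

namespace SymbData

variable {k : ℕ}

/-- CLOSURE PATTERN-FREE CHECK, odd matrix: `det M_odd(d) = 1` (verified product check) and the closure check on the bitmask rows of
`M_odd(d)`. Sound: every `d'` agreeing with `d` off `Q × Q` has `det M_odd(d') = 1` (`…SymbolicMonskyClosureSymb.lean`). -/
def pfClosureCheckOdd (d : SymbData k) (Q : Fin k → Bool) : Bool :=
  d.detCheckOdd && closureCheckRows k Q d.rowsOdd

/-- CLOSURE PATTERN-FREE CHECK, even matrix (same with `M_even`). -/
def pfClosureCheckEven (d : SymbData k) (Q : Fin k → Bool) : Bool :=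
  d.detCheckEven && closureCheckRows k Q d.rowsEven

end SymbData

/-- CLOSURE RECIPE CHECK, odd base `E_{P₀⋯P_k}`: Heegner check and the closure check of `dataK` at the reference pattern "all mutual
symbols `+1`" on the auxiliary block. One Boolean check per (base, cells); no mutual symbol enters. -/
def pfClosureRecipeOdd {k : ℕ} (base : SymbData (k + 1)) (aux : List AuxCell) : Bool :=
  heegnerK base aux && (dataK base aux fun _ _ => false).pfClosureCheckOdd (auxQ k aux.length)

/-- CLOSURE RECIPE CHECK, even base `E_{2P₀⋯P_k}`. -/
def pfClosureRecipeEven {k : ℕ} (base : SymbData (k + 1)) (aux : List AuxCell) : Bool :=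
  heegnerK base aux && (dataK base aux fun _ _ => false).pfClosureCheckEven (auxQ k aux.length)

end Summit.BirchSwinnertonDyer.BirchSwinnertonDyer.Theorems.SymbolicMonsky
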